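/-
Copyright (c) 2026 the pub-hodgecm-mathlib formalisation cell (harness21).  Prover seat hodgecm-mathlib-B-p14 (g30), (F11) «ramified torus `(EL)¹ × E¹`» of
MAP v3 (architect A-p06 (g26)); LEAD F0P3a-plan (g9) WORDS T8-41, T8-45 (line «N7nsCount», `stub_countIrredClause`), 2026-09-01.
-/
import Literature.NumberTheory.Rogawski1990.LocalStableClassesNonsplitRankTwoIrreducible      -- ★ p840760 (F11-a): ONE class on the `H`-side (this seat)
import Literature.NumberTheory.Rogawski1990.LocalStableClassesNonsplitKappaCountTypeTwo       -- ★ p840614 (F0P3-p02): the TWO classes and their `κ`-signs (over ★ B-p14 p840364∕p840535)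
import Literature.NumberTheory.Rogawski1990.FinExplicitTransferFactorInertPlaceValuation     -- ★ (D2): `Δ‴_v = (−q)^{−ord χ_g(u)} · κ_v` at a non-split unramified place
import Mathlib.Algebra.Polynomial.SpecificDegree                                           -- (ED. 2) `irreducible_of_degree_le_three_of_not_isRoot`
import HarnessLib

/-!
# The (P3)-irreducible clause of the inert unit fundamental lemma FROM THE THREE VALUES — head shape of `stub_countIrredClause`
# (Flicker 1998, Theorem 18 p. 97: `Δ_{G∕H}(t)·(Φ(t) − Φ′(t″)) = Φ_H(t)`; Rogawski 1990, Prop. 4.9.1 (b), (4.3.1)–(4.3.2))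

Topic `NumberTheory/Rogawski1990`; namespace `Literature.NumberTheory.Rogawski1990`.  THEOREMS ONLY (no definition, no instance, no notation, no named fact,
no `sorry`).  Cell `pub/hodgecm-mathlib`, crux H413 = `stmt-HodgeConjecture-24833`, P3a road «D-N7-inert», MAP v3 brick **(F11)**, sub-brick (F11-e): the
ASSEMBLY SHAPE of the line «N7nsCount» stub `stub_countIrredClause` (torus `T ≃ (EL)¹ × E¹`), with the three orbital-integral VALUES as hypotheses — the type-(2)
twin of B-p10 (g24)'s ★ (L5) head shape `stableOrbitalIntegralRel_indicator_eq_div_of_two_classes_of_values`.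

THE MATHEMATICS.  At a finite place `v` of `L⁺` non-split and unramified in the CM field `L` (`w ∣ v`, `q_v = #k_v`), for a matching pair `ι_v(γ_H) ↔ γ′`
(`γ_H = (g, u) ∈ H_v = U(Φ₂) × U(Φ₁)`, `γ′ ∈ G′_v = U(H′_v)`, `χ_g(u)` a unit) whose `U(Φ₂)`-component `g` has IRREDUCIBLE characteristic polynomial over `L_v`
(Flicker's torus `T_H ≃ (EL)¹ × E¹`) and a block frame `γ′P = P[A 0; 0 u]` (`χ_A` irreducible):
* the `H`-side stable class of `γ_H` is ONE class (★ (F11-a) `stableOrbitalIntegralRel_eq_classOrbitalIntegral_of_irreducible`): `Φ^st(γ_H, f^H) = Φ(⟦γ_H⟧, f^H)`;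
* the `G′`-side stable class of `γ′` is TWO classes `c₀ ∋ γ′`, `c₁`, with `κ_v(γ_H, c₁) = −κ_v(γ_H, c₀)`, `κ_v = ±1` (★ `exists_conjClassesIn_eq_two_finKappaAt`,
  ★ `finKappaAt_eq_one_or_eq_neg_one_of_isUnit`); `Δ‴_v(γ_H, ·)` is supported on them (★ `finExplicitDelta_of_not_isLocalNormPair`) and equals
  `Z · κ_v(γ_H, ·)` there, `Z = (−q_v)^{−ord_w χ_g(u)}` (★ (D2) `finExplicitDelta_eq_neg_absNorm_zpow_mul_kappa_of_nonsplit_of_isUnramifiedIn`).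
Hence `∑ᶠ c, Δ‴_v(γ_H, out c)·Φ(c, f) = Z·(Φ(c₊, f) − Φ(c₋, f))` with `c_±` the classes of sign `±1` (**`finsum_delta_mul_classOrbitalIntegral_eq_of_irreducible`**),
and the clause `Φ^st(γ_H, f^H) = ∑ᶠ c, Δ‴_v(γ_H, out c)·Φ(c, f)` FOLLOWS FROM THE THREE VALUES `Φ(c₊, f) = X`, `Φ(c₋, f) = X′`, `Φ(⟦γ_H⟧, f^H) = Y` and the one
line of algebra `Z·(X − X′) = Y` (**`stableOrbitalIntegralRel_eq_finsum_delta_of_irreducible_of_values`**) — for `f = 1_K`, `f^H = 1_{K_H}` this algebra is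
Flicker's THEOREM 18 with `X = φ_{T_H}`, `X′ = φ′_{T_H}`, `Y = Φ_H`, `−ord_w χ_g(u) = −n = −min(1+2N, 2+2N₂)` (★-to-be `Flicker1998.flicker_theorem18_div`; the
VALUES are (F11-c)∕(F9), the lattice counts of Props. 10–11, 16–17 and of `U(1,1)`).
HONEST LABEL: HC_CM is proved only modulo the printed citations until rung 0 closes; this file proves the bookkeeping, not the counts.

## References
* [Flicker1998UnitaryFL] Y. Z. Flicker, *Elementary proof of the fundamental lemma for a unitary group*, Canad. J. Math. 50 (1998), Prop. 3 p. 78, Theorem 18 p. 97.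
* [Rogawski1990] J. D. Rogawski, *Automorphic Representations of Unitary Groups in Three Variables*, Ann. of Math. Stud. 123 (1990), §4.3 (4.3.1)–(4.3.2) p. 43,
  §4.9 Prop. 4.9.1 (b) p. 55, §3.6 p. 31, p. 78.
* [Kottwitz1986] R. E. Kottwitz, *Stable trace formula: elliptic singular terms*, Math. Ann. 275 (1986), §7.
-/

set_option autoImplicit false

noncomputable section

open NumberField IsDedekindDomain Matrix
open scoped MatrixGroups

namespace Literature.NumberTheory.Rogawski1990

open Literature.NumberTheory.Automorphic Literature.NumberTheory.Automorphic.UnitaryGroup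
open Literature.NumberTheory.GaloisRepresentations Literature.NumberTheory.NumberFields Literature.NumberTheory.QuadraticForms
open Literature.AlgebraicGeometry.ShimuraVarieties (unitaryGroup mem_unitaryGroup_iff)

section Clause

variable (L : Type) [Field L] [NumberField L] [IsCMField L] (v : HeightOneSpectrum (𝓞 ↥(maximalRealSubfield L)))
  (H' : Matrix (Fin 3) (Fin 3) L)
  (a : (UnitaryGroup.cmDatum L 2 (Matrix.of fun i j : Fin 2 => if i.val + j.val + 1 = 2 then (1 : L) else 0)).Local v ×
      (UnitaryGroup.cmDatum L 1 (Matrix.of fun i j : Fin 1 => if i.val + j.val + 1 = 1 then (1 : L) else 0)).Local v)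
  (b : (UnitaryGroup.cmDatum L 3 H').Local v)
  (w : UnitaryGroup.PlacesOver L v) (hw : IsCMField.complexConj L • w.1 = w.1)

/-- `Δ‴_v(γ_H, ·)` only charges the stable class of a match: `Δ‴_v(γ_H, δ) ≠ 0 ⇒ ⟦δ⟧ ∈ conjClassesIn γ′`. [cite: Rogawski1990, §4.3 p. 43] -/
theorem mk_mem_conjClassesIn_of_finExplicitDelta_ne_zero (μ : HeckeCharacter L) (h : IsLocalNormPair L H' v a b)
    {δ : (UnitaryGroup.cmDatum L 3 H').Local v} (hΔ : finExplicitDelta L v H' a μ δ ≠ 0) :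
    ConjClasses.mk (⟨δ.val, δ.2⟩ : unitaryGroup (UnitaryGroup.conjLocal L (IsCMField.complexConj L) v)
        ((UnitaryGroup.adelicForm L 3 H').map (UnitaryGroup.adeleToLocal L v))) ∈
      conjClassesIn (UnitaryGroup.conjLocal L (IsCMField.complexConj L) v)
        ((UnitaryGroup.adelicForm L 3 H').map (UnitaryGroup.adeleToLocal L v)) ⟨b.val, b.2⟩ := by
  classical
  have hδ : IsLocalNormPair L H' v a δ := by
    by_contra hn
    exact hΔ (finExplicitDelta_of_not_isLocalNormPair L v H' a μ hn)
  rw [isLocalNormPair_iff] at h hδ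
  exact mk_mem_conjClassesIn_iff.2 (h.isStablyConj_right hδ)

/-- A class in the stable class of the match `γ′` is matched: `⟦δ⟧ ∈ conjClassesIn γ′ ⇒ ι_v(γ_H) ↔ δ`. [cite: Rogawski1990, §4.3 p. 43] -/
theorem isLocalNormPair_of_mk_mem_conjClassesIn (h : IsLocalNormPair L H' v a b) {δ : (UnitaryGroup.cmDatum L 3 H').Local v}
    (hδ : ConjClasses.mk (⟨δ.val, δ.2⟩ : unitaryGroup (UnitaryGroup.conjLocal L (IsCMField.complexConj L) v)
        ((UnitaryGroup.adelicForm L 3 H').map (UnitaryGroup.adeleToLocal L v))) ∈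
      conjClassesIn (UnitaryGroup.conjLocal L (IsCMField.complexConj L) v)
        ((UnitaryGroup.adelicForm L 3 H').map (UnitaryGroup.adeleToLocal L v)) ⟨b.val, b.2⟩) :
    IsLocalNormPair L H' v a δ := by
  rw [isLocalNormPair_iff] at h ⊢
  exact h.of_isStablyConj_right (mk_mem_conjClassesIn_iff.1 hδ)

set_option maxHeartbeats 400000 in
include hw in
open scoped Classical in
/-- **THE `G′`-SIDE OF THE CLAUSE ON A TYPE-(2) STABLE CLASS: `∑ᶠ c, Δ‴_v(γ_H, out c)·Φ(c, f) = Z·(Φ(c₊, f) − Φ(c₋, f))`**, `Z = (−q_v)^{−ord_w χ_g(u)}`,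
where `c_±` are the classes of the stable class of `γ′` with `κ_v(γ_H, c_±) = ±1` — read through the values: if `Φ(⟦δ⟧, f) = X` on every matched `δ` with
`κ_v(γ_H, δ) = 1` and `= X′` on every matched `δ` with `κ_v(γ_H, δ) = −1`, the sum is `Z·(X − X′)` (any `f`, any orbital-measure family).
[cite: Rogawski1990, §4.3 (4.3.1)–(4.3.2) p. 43; §4.9 Prop. 4.9.1 (b) p. 55; §3.5 Prop. 3.5.2 (c) p. 29] [cite: Flicker1998UnitaryFL, Theorem 18 p. 97] -/
theorem finsum_delta_mul_classOrbitalIntegral_eq_of_irreducible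
    [∀ γ : (UnitaryGroup.cmDatum L 3 H').Local v,
    MeasurableSpace (((UnitaryGroup.cmDatum L 3 H').Local v) ⧸ Subgroup.centralizer ({γ} : Set ((UnitaryGroup.cmDatum L 3 H').Local v)))]
    (μ : HeckeCharacter L)
    (hμω : ∀ x : ideleGroup ↥(maximalRealSubfield L), μ (AdeleRing.ideleBaseChange ↥(maximalRealSubfield L) L x) = quadraticHeckeCharCM L x)
    (hunr : Algebra.IsUnramifiedIn (𝓞 L) v.asIdeal) (hμ : μ.IsUnramifiedAt w.1)
    (hl : ∀ (v : HeightOneSpectrum (𝓞 ↥(maximalRealSubfield L)))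
      (a : (UnitaryGroup.cmDatum L 2 (Matrix.of fun i j : Fin 2 => if i.val + j.val + 1 = 2 then (1 : L) else 0)).Local v ×
      (UnitaryGroup.cmDatum L 1 (Matrix.of fun i j : Fin 1 => if i.val + j.val + 1 = 1 then (1 : L) else 0)).Local v)
      (b : (UnitaryGroup.cmDatum L 3 H').Local v)
      (x : (UnitaryGroup.cmDatum L 2 (Matrix.of fun i j : Fin 2 => if i.val + j.val + 1 = 2 then (1 : L) else 0)).Local v ×
      (UnitaryGroup.cmDatum L 1 (Matrix.of fun i j : Fin 1 => if i.val + j.val + 1 = 1 then (1 : L) else 0)).Local v),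
      finExplicitDelta L v H' (x * a * x⁻¹) μ b = finExplicitDelta L v H' a μ b)
    (hr : ∀ (v : HeightOneSpectrum (𝓞 ↥(maximalRealSubfield L)))
      (a : (UnitaryGroup.cmDatum L 2 (Matrix.of fun i j : Fin 2 => if i.val + j.val + 1 = 2 then (1 : L) else 0)).Local v ×
      (UnitaryGroup.cmDatum L 1 (Matrix.of fun i j : Fin 1 => if i.val + j.val + 1 = 1 then (1 : L) else 0)).Local v)
      (b y : (UnitaryGroup.cmDatum L 3 H').Local v),
      finExplicitDelta L v H' a μ (y * b * y⁻¹) = finExplicitDelta L v H' a μ b)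
    (h : IsLocalNormPair L H' v a b) (hu : IsUnit ((finCharpolyTwo L v a).eval (finGammaTwo L v a)))
    (hH : (((UnitaryGroup.adelicForm L 3 H').map (UnitaryGroup.adeleToLocal L v)).map
      (UnitaryGroup.conjLocal L (IsCMField.complexConj L) v))ᵀ = (UnitaryGroup.adelicForm L 3 H').map (UnitaryGroup.adeleToLocal L v))
    (hHd : IsUnit ((UnitaryGroup.adelicForm L 3 H').map (UnitaryGroup.adeleToLocal L v)).det) (e : Fin 2 ⊕ Fin 1 ≃ Fin 3)
    {P : GL (Fin 3) (UnitaryGroup.LocalRing L v)} {A : Matrix (Fin 2) (Fin 2) (UnitaryGroup.LocalRing L v)}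
    (hP : (b.val.val : Matrix (Fin 3) (Fin 3) (UnitaryGroup.LocalRing L v)) * P.val = P.val * reindex e e (fromBlocks A 0 0 !![finGammaTwo L v a]))
    (hA : Irreducible A.charpoly) (mG : OrbitalMeasureFamily ((UnitaryGroup.cmDatum L 3 H').Local v))
    (f : (UnitaryGroup.cmDatum L 3 H').Local v → ℂ) {X X' : ℂ}
    (hΦ : ∀ δ : (UnitaryGroup.cmDatum L 3 H').Local v, IsLocalNormPair L H' v a δ → finKappaAt L v H' a δ = 1 →
      classOrbitalIntegral mG f (ConjClasses.mk δ) = X)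
    (hΦ' : ∀ δ : (UnitaryGroup.cmDatum L 3 H').Local v, IsLocalNormPair L H' v a δ → finKappaAt L v H' a δ = -1 →
      classOrbitalIntegral mG f (ConjClasses.mk δ) = X') :
    ∑ᶠ c : ConjClasses ((UnitaryGroup.cmDatum L 3 H').Local v),
        (finExplicitCollection L H' μ hl hr v).Δ a (Quotient.out c) * classOrbitalIntegral mG f c =
      (-(Ideal.absNorm v.asIdeal : ℂ)) ^ WithZero.log (Valued.v (((finCharpolyTwo L v a).eval (finGammaTwo L v a)) w)) * (X - X') := by
  -- the two classes and their signs
  obtain ⟨c₀, c₁, hS, hne, hκ₀, hκ₁⟩ := exists_conjClassesIn_eq_two_finKappaAt L v H' a b w hw h hu hH hHd e hP hA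
  set Z : ℂ := (-(Ideal.absNorm v.asIdeal : ℂ)) ^ WithZero.log (Valued.v (((finCharpolyTwo L v a).eval (finGammaTwo L v a)) w)) with hZ
  set F : ConjClasses ((UnitaryGroup.cmDatum L 3 H').Local v) → ℂ :=
    fun c => (finExplicitCollection L H' μ hl hr v).Δ a (Quotient.out c) * classOrbitalIntegral mG f c with hF
  -- every class reads as `⟦out c⟧`
  have hmk : ∀ c : ConjClasses ((UnitaryGroup.cmDatum L 3 H').Local v),
      ConjClasses.mk (⟨(Quotient.out c).val, (Quotient.out c).2⟩ : unitaryGroup (UnitaryGroup.conjLocal L (IsCMField.complexConj L) v)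
        ((UnitaryGroup.adelicForm L 3 H').map (UnitaryGroup.adeleToLocal L v))) = c := fun c => Quotient.out_eq c
  -- support inside the pair
  have hsupp : Function.support F ⊆ ({c₀, c₁} : Set (ConjClasses ((UnitaryGroup.cmDatum L 3 H').Local v))) := by
    intro c hc
    rw [Function.mem_support] at hc
    have hΔ : finExplicitDelta L v H' a μ (Quotient.out c) ≠ 0 := by
      intro h0
      apply hc
      simp only [hF, finExplicitCollection_Δ, h0, zero_mul]
    have hmem := mk_mem_conjClassesIn_of_finExplicitDelta_ne_zero L v H' a b μ h hΔ
    rwa [hmk, hS] at hmem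
  rw [← finsum_mem_univ, finsum_mem_inter_support_eq' F Set.univ {c₀, c₁} (fun x hx => ⟨fun _ => hsupp hx, fun _ => Set.mem_univ _⟩)]
  refine (finsum_mem_pair (f := F) hne).trans ?_
  -- the value of `Δ` and of `κ` on the two classes (read on the `cmDatum` carrier, as in the goal)
  have hval : ∀ c : ConjClasses ((UnitaryGroup.cmDatum L 3 H').Local v),
      c ∈ conjClassesIn (UnitaryGroup.conjLocal L (IsCMField.complexConj L) v)
        ((UnitaryGroup.adelicForm L 3 H').map (UnitaryGroup.adeleToLocal L v)) ⟨b.val, b.2⟩ →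
      IsLocalNormPair L H' v a (Quotient.out c) ∧
        (finExplicitCollection L H' μ hl hr v).Δ a (Quotient.out c) = Z * ((finKappaAt L v H' a (Quotient.out c) : ℤ) : ℂ) ∧
        (c = c₀ → finKappaAt L v H' a (Quotient.out c) = finKappaAt L v H' a b) ∧
        (c = c₁ → finKappaAt L v H' a (Quotient.out c) = -finKappaAt L v H' a b) := by
    intro c hc
    have hc' := hc
    rw [← hmk c] at hc'
    have hn := isLocalNormPair_of_mk_mem_conjClassesIn L v H' a b h hc'
    refine ⟨hn, ?_, fun h0 => hκ₀ _ ((hmk c).trans h0), fun h1 => hκ₁ _ ((hmk c).trans h1)⟩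
    rw [finExplicitCollection_Δ,
      finExplicitDelta_eq_neg_absNorm_zpow_mul_kappa_of_nonsplit_of_isUnramifiedIn L v H' a (Quotient.out c) w hw μ hμω hunr hμ hn hu]
  have hc₀ : (c₀ : ConjClasses ((UnitaryGroup.cmDatum L 3 H').Local v)) ∈ conjClassesIn (UnitaryGroup.conjLocal L (IsCMField.complexConj L) v)
      ((UnitaryGroup.adelicForm L 3 H').map (UnitaryGroup.adeleToLocal L v)) ⟨b.val, b.2⟩ := by rw [hS]; exact Set.mem_insert _ _
  have hc₁ : (c₁ : ConjClasses ((UnitaryGroup.cmDatum L 3 H').Local v)) ∈ conjClassesIn (UnitaryGroup.conjLocal L (IsCMField.complexConj L) v)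
      ((UnitaryGroup.adelicForm L 3 H').map (UnitaryGroup.adeleToLocal L v)) ⟨b.val, b.2⟩ := by
    rw [hS]; exact Set.mem_insert_of_mem _ (Set.mem_singleton _)
  obtain ⟨hn₀, hΔ₀, hk₀, -⟩ := hval c₀ hc₀
  obtain ⟨hn₁, hΔ₁, -, hk₁⟩ := hval c₁ hc₁
  replace hk₀ := hk₀ rfl
  replace hk₁ := hk₁ rfl
  simp only [hF]
  rw [hΔ₀, hΔ₁, hk₀, hk₁]
  -- classes read back from their representatives, on the `cmDatum` carrier
  have hmk' : ∀ c : ConjClasses ((UnitaryGroup.cmDatum L 3 H').Local v), ConjClasses.mk (Quotient.out c) = c := fun c => Quotient.out_eq c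
  -- the sign of `γ′` itself
  rcases finKappaAt_eq_one_or_eq_neg_one_of_isUnit L v H' a b h hu with hκ | hκ
  · have hX : classOrbitalIntegral mG f c₀ = X := by
      have h0 := hΦ _ hn₀ (hk₀.trans hκ)
      rwa [hmk' c₀] at h0
    have hX' : classOrbitalIntegral mG f c₁ = X' := by
      have h1 := hΦ' _ hn₁ (hk₁.trans (by rw [hκ]))
      rwa [hmk' c₁] at h1
    rw [hX, hX', hκ]
    push_cast
    ring
  · have hX' : classOrbitalIntegral mG f c₀ = X' := by
      have h0 := hΦ' _ hn₀ (hk₀.trans hκ)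
      rwa [hmk' c₀] at h0
    have hX : classOrbitalIntegral mG f c₁ = X := by
      have h1 := hΦ _ hn₁ (hk₁.trans (by rw [hκ, neg_neg]))
      rwa [hmk' c₁] at h1
    rw [hX, hX', hκ]
    push_cast
    ring

include hw in
open scoped Classical in
/-- **`stub_countIrredClause` FROM THE THREE VALUES** (the assembly shape of MAP v3 (F11)).  In the frame of the previous theorem, if moreover the
`U(Φ₂)`-component of `γ_H` has irreducible characteristic polynomial over `L_v` (`Φ₂`-local hermitian with unit determinant), the `H`-side is ONE class
(★ (F11-a)), and the clause `Φ^st(γ_H, f^H) = ∑ᶠ c, Δ‴_v(γ_H, out c)·Φ(c, f)` holds as soon as the three values `X = Φ(c₊, f)`, `X′ = Φ(c₋, f)`, `Y = Φ(⟦γ_H⟧, f^H)`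
satisfy `Z·(X − X′) = Y`, `Z = (−q_v)^{−ord_w χ_g(u)}` — for `f = 1_K`, `f^H = 1_{K_H}` exactly Flicker's THEOREM 18 `Δ_{G∕H}(t)Φ^κ_{1_K}(t) = Φ^st_{1_{K_H}}(t)` with
`Φ^κ = Φ(t) − Φ′(t″)`. [cite: Flicker1998UnitaryFL, Theorem 18 p. 97] [cite: Rogawski1990, §4.9 Prop. 4.9.1 (b) p. 55; §4.3 (4.3.1) p. 43] -/
theorem stableOrbitalIntegralRel_eq_finsum_delta_of_irreducible_of_values
    [∀ γ : (UnitaryGroup.cmDatum L 3 H').Local v,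
    MeasurableSpace (((UnitaryGroup.cmDatum L 3 H').Local v) ⧸ Subgroup.centralizer ({γ} : Set ((UnitaryGroup.cmDatum L 3 H').Local v)))]
    [∀ x : (UnitaryGroup.cmDatum L 2 (Matrix.of fun i j : Fin 2 => if i.val + j.val + 1 = 2 then (1 : L) else 0)).Local v ×
      (UnitaryGroup.cmDatum L 1 (Matrix.of fun i j : Fin 1 => if i.val + j.val + 1 = 1 then (1 : L) else 0)).Local v,
    MeasurableSpace (((UnitaryGroup.cmDatum L 2 (Matrix.of fun i j : Fin 2 => if i.val + j.val + 1 = 2 then (1 : L) else 0)).Local v ×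
      (UnitaryGroup.cmDatum L 1 (Matrix.of fun i j : Fin 1 => if i.val + j.val + 1 = 1 then (1 : L) else 0)).Local v) ⧸
      Subgroup.centralizer ({x} : Set ((UnitaryGroup.cmDatum L 2 (Matrix.of fun i j : Fin 2 => if i.val + j.val + 1 = 2 then (1 : L) else 0)).Local v ×
      (UnitaryGroup.cmDatum L 1 (Matrix.of fun i j : Fin 1 => if i.val + j.val + 1 = 1 then (1 : L) else 0)).Local v)))]
    (μ : HeckeCharacter L)
    (hμω : ∀ x : ideleGroup ↥(maximalRealSubfield L), μ (AdeleRing.ideleBaseChange ↥(maximalRealSubfield L) L x) = quadraticHeckeCharCM L x)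
    (hunr : Algebra.IsUnramifiedIn (𝓞 L) v.asIdeal) (hμ : μ.IsUnramifiedAt w.1)
    (hl : ∀ (v : HeightOneSpectrum (𝓞 ↥(maximalRealSubfield L)))
      (a : (UnitaryGroup.cmDatum L 2 (Matrix.of fun i j : Fin 2 => if i.val + j.val + 1 = 2 then (1 : L) else 0)).Local v ×
      (UnitaryGroup.cmDatum L 1 (Matrix.of fun i j : Fin 1 => if i.val + j.val + 1 = 1 then (1 : L) else 0)).Local v)
      (b : (UnitaryGroup.cmDatum L 3 H').Local v)
      (x : (UnitaryGroup.cmDatum L 2 (Matrix.of fun i j : Fin 2 => if i.val + j.val + 1 = 2 then (1 : L) else 0)).Local v ×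
      (UnitaryGroup.cmDatum L 1 (Matrix.of fun i j : Fin 1 => if i.val + j.val + 1 = 1 then (1 : L) else 0)).Local v),
      finExplicitDelta L v H' (x * a * x⁻¹) μ b = finExplicitDelta L v H' a μ b)
    (hr : ∀ (v : HeightOneSpectrum (𝓞 ↥(maximalRealSubfield L)))
      (a : (UnitaryGroup.cmDatum L 2 (Matrix.of fun i j : Fin 2 => if i.val + j.val + 1 = 2 then (1 : L) else 0)).Local v ×
      (UnitaryGroup.cmDatum L 1 (Matrix.of fun i j : Fin 1 => if i.val + j.val + 1 = 1 then (1 : L) else 0)).Local v)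
      (b y : (UnitaryGroup.cmDatum L 3 H').Local v),
      finExplicitDelta L v H' a μ (y * b * y⁻¹) = finExplicitDelta L v H' a μ b)
    (h : IsLocalNormPair L H' v a b) (hu : IsUnit ((finCharpolyTwo L v a).eval (finGammaTwo L v a)))
    (hH : (((UnitaryGroup.adelicForm L 3 H').map (UnitaryGroup.adeleToLocal L v)).map
      (UnitaryGroup.conjLocal L (IsCMField.complexConj L) v))ᵀ = (UnitaryGroup.adelicForm L 3 H').map (UnitaryGroup.adeleToLocal L v))
    (hHd : IsUnit ((UnitaryGroup.adelicForm L 3 H').map (UnitaryGroup.adeleToLocal L v)).det) (e : Fin 2 ⊕ Fin 1 ≃ Fin 3)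
    {P : GL (Fin 3) (UnitaryGroup.LocalRing L v)} {A : Matrix (Fin 2) (Fin 2) (UnitaryGroup.LocalRing L v)}
    (hP : (b.val.val : Matrix (Fin 3) (Fin 3) (UnitaryGroup.LocalRing L v)) * P.val = P.val * reindex e e (fromBlocks A 0 0 !![finGammaTwo L v a]))
    (hA : Irreducible A.charpoly)
    (hΦ₂ : ((((UnitaryGroup.adelicForm L 2 (Matrix.of fun i j : Fin 2 => if i.val + j.val + 1 = 2 then (1 : L) else 0)).map (UnitaryGroup.adeleToLocal L v)).map
      (UnitaryGroup.conjLocal L (IsCMField.complexConj L) v))ᵀ =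
        (UnitaryGroup.adelicForm L 2 (Matrix.of fun i j : Fin 2 => if i.val + j.val + 1 = 2 then (1 : L) else 0)).map (UnitaryGroup.adeleToLocal L v)))
    (hΦ₂d : IsUnit ((UnitaryGroup.adelicForm L 2 (Matrix.of fun i j : Fin 2 => if i.val + j.val + 1 = 2 then (1 : L) else 0)).map (UnitaryGroup.adeleToLocal L v)).det)
    (hirr : Irreducible ((a.1.val : GL (Fin 2) (UnitaryGroup.LocalRing L v)).val.charpoly))
    (mH : OrbitalMeasureFamily ((UnitaryGroup.cmDatum L 2 (Matrix.of fun i j : Fin 2 => if i.val + j.val + 1 = 2 then (1 : L) else 0)).Local v ×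
      (UnitaryGroup.cmDatum L 1 (Matrix.of fun i j : Fin 1 => if i.val + j.val + 1 = 1 then (1 : L) else 0)).Local v))
    (mG : OrbitalMeasureFamily ((UnitaryGroup.cmDatum L 3 H').Local v))
    (fH : ((UnitaryGroup.cmDatum L 2 (Matrix.of fun i j : Fin 2 => if i.val + j.val + 1 = 2 then (1 : L) else 0)).Local v ×
      (UnitaryGroup.cmDatum L 1 (Matrix.of fun i j : Fin 1 => if i.val + j.val + 1 = 1 then (1 : L) else 0)).Local v) → ℂ)
    (f : (UnitaryGroup.cmDatum L 3 H').Local v → ℂ) {X X' Y : ℂ}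
    (hΦ : ∀ δ : (UnitaryGroup.cmDatum L 3 H').Local v, IsLocalNormPair L H' v a δ → finKappaAt L v H' a δ = 1 →
      classOrbitalIntegral mG f (ConjClasses.mk δ) = X)
    (hΦ' : ∀ δ : (UnitaryGroup.cmDatum L 3 H').Local v, IsLocalNormPair L H' v a δ → finKappaAt L v H' a δ = -1 →
      classOrbitalIntegral mG f (ConjClasses.mk δ) = X')
    (hΦH : classOrbitalIntegral mH fH (ConjClasses.mk a) = Y)
    (halg : (-(Ideal.absNorm v.asIdeal : ℂ)) ^ WithZero.log (Valued.v (((finCharpolyTwo L v a).eval (finGammaTwo L v a)) w)) * (X - X') = Y) :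
    stableOrbitalIntegralRel (IsLocalStablyConjH L v) mH fH a =
      ∑ᶠ c : ConjClasses ((UnitaryGroup.cmDatum L 3 H').Local v),
        (finExplicitCollection L H' μ hl hr v).Δ a (Quotient.out c) * classOrbitalIntegral mG f c := by
  rw [stableOrbitalIntegralRel_eq_classOrbitalIntegral_of_irreducible L v w hw hΦ₂ hΦ₂d mH fH a hirr, hΦH,
    finsum_delta_mul_classOrbitalIntegral_eq_of_irreducible L v H' a b w hw μ hμω hunr hμ hl hr h hu hH hHd e hP hA mG f hΦ hΦ', halg]

end Clause

/-! ## §3 (ED. 2) The stub's `hirr` token: «no root in `L_w`» ⇒ `Irreducible` over `L_v` at a non-split `v` -/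

section Bridge

variable (L : Type) [Field L] [NumberField L] [IsCMField L] (v : HeightOneSpectrum (𝓞 ↥(maximalRealSubfield L)))

/-- A CM field has a non-zero element negated by complex conjugation. [cite: Rogawski1990, §1.10] -/
private theorem exists_complexConj_eq_neg_ne_zero_ed2 : ∃ δ : L, IsCMField.complexConj L δ = -δ ∧ δ ≠ 0 := by
  obtain ⟨ζ, hζ⟩ := not_forall.1 fun h0 => IsCMField.complexConj_ne_one L (AlgEquiv.ext h0)
  refine ⟨ζ - IsCMField.complexConj L ζ, by rw [map_sub, IsCMField.complexConj_apply_apply, neg_sub], fun h0 => hζ ?_⟩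
  rw [sub_eq_zero] at h0
  exact h0.symm

/-- **THE `hirr` BRIDGE.**  At a finite place `v` of `L⁺` NOT split in `L` (`w ∣ v` with `c • w = w`; `L_v = ∏_{w′ ∣ v} L_{w′} = L_w` is a field), a `2 × 2`
matrix `g` over `L_v` whose `w`-component characteristic polynomial has NO ROOT in `L_w` (the line's token `hirr`) has IRREDUCIBLE characteristic polynomial over
`L_v` (monic of degree `2` without a root: ★ Mathlib `irreducible_of_degree_le_three_of_not_isRoot`; a root `y ∈ L_v` would give the root `y_w`).
[cite: Flicker1998UnitaryFL, Prop. 3 p. 78; p. 96 («`t′ ∈ T_{H′}`, the torus `(EL)¹ × E¹`»)] [cite: Rogawski1990, §3.6 p. 31] -/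
theorem irreducible_charpoly_of_not_exists_isRoot_eval (w : UnitaryGroup.PlacesOver L v) (hw : IsCMField.complexConj L • w.1 = w.1)
    (g : Matrix (Fin 2) (Fin 2) (UnitaryGroup.LocalRing L v))
    (hirr : ¬ ∃ x : w.1.adicCompletion L,
      ((g.map (Pi.evalRingHom (fun w' : UnitaryGroup.PlacesOver L v => w'.1.adicCompletion L) w)).charpoly).IsRoot x) :
    Irreducible g.charpoly := by
  obtain ⟨δ, hcδ, hδ⟩ := exists_complexConj_eq_neg_ne_zero_ed2 L
  letI : Field (UnitaryGroup.LocalRing L v) :=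
    (Liu2021.LemD1IndexedNonVacuityNonsplitPlace.isField_localRing_of_nonsplit L v (IsCMField.complexConj L) hcδ hδ w hw).toField
  refine Polynomial.irreducible_of_degree_le_three_of_not_isRoot ?_ fun y hy => hirr ⟨y w, ?_⟩
  · rw [Matrix.charpoly_natDegree_eq_dim, Fintype.card_fin]
    decide
  · rw [Matrix.charpoly_map]
    exact hy.map

variable (H' : Matrix (Fin 3) (Fin 3) L)
  (a : (UnitaryGroup.cmDatum L 2 (Matrix.of fun i j : Fin 2 => if i.val + j.val + 1 = 2 then (1 : L) else 0)).Local v ×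
      (UnitaryGroup.cmDatum L 1 (Matrix.of fun i j : Fin 1 => if i.val + j.val + 1 = 1 then (1 : L) else 0)).Local v)
  (b : (UnitaryGroup.cmDatum L 3 H').Local v)
  (w : UnitaryGroup.PlacesOver L v) (hw : IsCMField.complexConj L • w.1 = w.1)

include hw in
open scoped Classical in
/-- **`stub_countIrredClause` FROM THE THREE VALUES, `hirr` IN THE LINE'S TOKEN** (§2 with `Irreducible χ_g` replaced by «`χ_{g,w}` has no root in `L_w`» through
§3's bridge) — the shape the line edition consumes: after it only the (S0′) exponent dictionary, the three value heads and ★ THEOREM 18 remain.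
[cite: Flicker1998UnitaryFL, Theorem 18 p. 97] [cite: Rogawski1990, §4.9 Prop. 4.9.1 (b) p. 55; §4.3 (4.3.1) p. 43] -/
theorem stableOrbitalIntegralRel_eq_finsum_delta_of_not_exists_isRoot_of_values
    [∀ γ : (UnitaryGroup.cmDatum L 3 H').Local v,
    MeasurableSpace (((UnitaryGroup.cmDatum L 3 H').Local v) ⧸ Subgroup.centralizer ({γ} : Set ((UnitaryGroup.cmDatum L 3 H').Local v)))]
    [∀ x : (UnitaryGroup.cmDatum L 2 (Matrix.of fun i j : Fin 2 => if i.val + j.val + 1 = 2 then (1 : L) else 0)).Local v ×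
      (UnitaryGroup.cmDatum L 1 (Matrix.of fun i j : Fin 1 => if i.val + j.val + 1 = 1 then (1 : L) else 0)).Local v,
    MeasurableSpace (((UnitaryGroup.cmDatum L 2 (Matrix.of fun i j : Fin 2 => if i.val + j.val + 1 = 2 then (1 : L) else 0)).Local v ×
      (UnitaryGroup.cmDatum L 1 (Matrix.of fun i j : Fin 1 => if i.val + j.val + 1 = 1 then (1 : L) else 0)).Local v) ⧸
      Subgroup.centralizer ({x} : Set ((UnitaryGroup.cmDatum L 2 (Matrix.of fun i j : Fin 2 => if i.val + j.val + 1 = 2 then (1 : L) else 0)).Local v ×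
      (UnitaryGroup.cmDatum L 1 (Matrix.of fun i j : Fin 1 => if i.val + j.val + 1 = 1 then (1 : L) else 0)).Local v)))]
    (μ : HeckeCharacter L)
    (hμω : ∀ x : ideleGroup ↥(maximalRealSubfield L), μ (AdeleRing.ideleBaseChange ↥(maximalRealSubfield L) L x) = quadraticHeckeCharCM L x)
    (hunr : Algebra.IsUnramifiedIn (𝓞 L) v.asIdeal) (hμ : μ.IsUnramifiedAt w.1)
    (hl : ∀ (v : HeightOneSpectrum (𝓞 ↥(maximalRealSubfield L)))
      (a : (UnitaryGroup.cmDatum L 2 (Matrix.of fun i j : Fin 2 => if i.val + j.val + 1 = 2 then (1 : L) else 0)).Local v ×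
      (UnitaryGroup.cmDatum L 1 (Matrix.of fun i j : Fin 1 => if i.val + j.val + 1 = 1 then (1 : L) else 0)).Local v)
      (b : (UnitaryGroup.cmDatum L 3 H').Local v)
      (x : (UnitaryGroup.cmDatum L 2 (Matrix.of fun i j : Fin 2 => if i.val + j.val + 1 = 2 then (1 : L) else 0)).Local v ×
      (UnitaryGroup.cmDatum L 1 (Matrix.of fun i j : Fin 1 => if i.val + j.val + 1 = 1 then (1 : L) else 0)).Local v),
      finExplicitDelta L v H' (x * a * x⁻¹) μ b = finExplicitDelta L v H' a μ b)
    (hr : ∀ (v : HeightOneSpectrum (𝓞 ↥(maximalRealSubfield L)))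
      (a : (UnitaryGroup.cmDatum L 2 (Matrix.of fun i j : Fin 2 => if i.val + j.val + 1 = 2 then (1 : L) else 0)).Local v ×
      (UnitaryGroup.cmDatum L 1 (Matrix.of fun i j : Fin 1 => if i.val + j.val + 1 = 1 then (1 : L) else 0)).Local v)
      (b y : (UnitaryGroup.cmDatum L 3 H').Local v),
      finExplicitDelta L v H' a μ (y * b * y⁻¹) = finExplicitDelta L v H' a μ b)
    (h : IsLocalNormPair L H' v a b) (hu : IsUnit ((finCharpolyTwo L v a).eval (finGammaTwo L v a)))
    (hH : (((UnitaryGroup.adelicForm L 3 H').map (UnitaryGroup.adeleToLocal L v)).map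
      (UnitaryGroup.conjLocal L (IsCMField.complexConj L) v))ᵀ = (UnitaryGroup.adelicForm L 3 H').map (UnitaryGroup.adeleToLocal L v))
    (hHd : IsUnit ((UnitaryGroup.adelicForm L 3 H').map (UnitaryGroup.adeleToLocal L v)).det) (e : Fin 2 ⊕ Fin 1 ≃ Fin 3)
    {P : GL (Fin 3) (UnitaryGroup.LocalRing L v)} {A : Matrix (Fin 2) (Fin 2) (UnitaryGroup.LocalRing L v)}
    (hP : (b.val.val : Matrix (Fin 3) (Fin 3) (UnitaryGroup.LocalRing L v)) * P.val = P.val * reindex e e (fromBlocks A 0 0 !![finGammaTwo L v a]))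
    (hA : Irreducible A.charpoly)
    (hΦ₂ : ((((UnitaryGroup.adelicForm L 2 (Matrix.of fun i j : Fin 2 => if i.val + j.val + 1 = 2 then (1 : L) else 0)).map (UnitaryGroup.adeleToLocal L v)).map
      (UnitaryGroup.conjLocal L (IsCMField.complexConj L) v))ᵀ =
        (UnitaryGroup.adelicForm L 2 (Matrix.of fun i j : Fin 2 => if i.val + j.val + 1 = 2 then (1 : L) else 0)).map (UnitaryGroup.adeleToLocal L v)))
    (hΦ₂d : IsUnit ((UnitaryGroup.adelicForm L 2 (Matrix.of fun i j : Fin 2 => if i.val + j.val + 1 = 2 then (1 : L) else 0)).map (UnitaryGroup.adeleToLocal L v)).det)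
    (hirr : ¬ ∃ x : w.1.adicCompletion L, ((((a.1.val : GL (Fin 2) (UnitaryGroup.LocalRing L v)).val.map
        (Pi.evalRingHom (fun w' : UnitaryGroup.PlacesOver L v => w'.1.adicCompletion L) w)).charpoly).IsRoot x))
    (mH : OrbitalMeasureFamily ((UnitaryGroup.cmDatum L 2 (Matrix.of fun i j : Fin 2 => if i.val + j.val + 1 = 2 then (1 : L) else 0)).Local v ×
      (UnitaryGroup.cmDatum L 1 (Matrix.of fun i j : Fin 1 => if i.val + j.val + 1 = 1 then (1 : L) else 0)).Local v))
    (mG : OrbitalMeasureFamily ((UnitaryGroup.cmDatum L 3 H').Local v))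
    (fH : ((UnitaryGroup.cmDatum L 2 (Matrix.of fun i j : Fin 2 => if i.val + j.val + 1 = 2 then (1 : L) else 0)).Local v ×
      (UnitaryGroup.cmDatum L 1 (Matrix.of fun i j : Fin 1 => if i.val + j.val + 1 = 1 then (1 : L) else 0)).Local v) → ℂ)
    (f : (UnitaryGroup.cmDatum L 3 H').Local v → ℂ) {X X' Y : ℂ}
    (hΦ : ∀ δ : (UnitaryGroup.cmDatum L 3 H').Local v, IsLocalNormPair L H' v a δ → finKappaAt L v H' a δ = 1 →
      classOrbitalIntegral mG f (ConjClasses.mk δ) = X)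
    (hΦ' : ∀ δ : (UnitaryGroup.cmDatum L 3 H').Local v, IsLocalNormPair L H' v a δ → finKappaAt L v H' a δ = -1 →
      classOrbitalIntegral mG f (ConjClasses.mk δ) = X')
    (hΦH : classOrbitalIntegral mH fH (ConjClasses.mk a) = Y)
    (halg : (-(Ideal.absNorm v.asIdeal : ℂ)) ^ WithZero.log (Valued.v (((finCharpolyTwo L v a).eval (finGammaTwo L v a)) w)) * (X - X') = Y) :
    stableOrbitalIntegralRel (IsLocalStablyConjH L v) mH fH a =
      ∑ᶠ c : ConjClasses ((UnitaryGroup.cmDatum L 3 H').Local v),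
        (finExplicitCollection L H' μ hl hr v).Δ a (Quotient.out c) * classOrbitalIntegral mG f c :=
  stableOrbitalIntegralRel_eq_finsum_delta_of_irreducible_of_values L v H' a b w hw μ hμω hunr hμ hl hr h hu hH hHd e hP hA hΦ₂ hΦ₂d
    (irreducible_charpoly_of_not_exists_isRoot_eval L v w hw _ hirr) mH mG fH f hΦ hΦ' hΦH halg

end Bridge

end Literature.NumberTheory.Rogawski1990

end
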